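import Summits.QuantumFields.YangMills.Theorems.UnitScaleTiltProp7LocalModelBlend
import HarnessLib

/-!
# Route `UnitScaleTilt`, crux K1 «MinimiserStabilityRegPr» (stmt-QuantumFields-19200), route-R E′ path (α′), S3 K-form engine, rows (R4′)∕(H) — FILE 9p₁ (abstract):
# THE LOCAL-MODEL BLEND WITH A POINTWISE RECENTRING GROUP — ✓p665619 `sum_sq_norm_lap_localBlend_le[_supp]` RESHAPED: the undifferentiated (second-difference) group is
# priced `3·|ι|·G₂²·Σ_y Σ_(z : N y z) Σ_μ ‖Ψ_y(z) − Z_μ(z)‖²` (row mass `G₂` of `|Δ²_μW_y|` used twice — as the Cauchy–Schwarz measure and as the pointwise bound) instead of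
# `3|ι|²G₂K₂·Σ_y G_y²` with a SUP-type data row `G_y`; no `G`, no `hG`: the recentring field `Z_μ(z)` (independent of `y`) is the only datum.  WHY (★p1 g16 R5 ⧗p677112
# row (H), junction (J-δV), routeR-w1 LOCATE 2026-08-28 23:16Z): a sup-type row cannot be booked by sum-type hKg′ rows; the pointwise group can (same `ℓ`-scaling).

Cell `ym3-torus`, D-0154 (3c) twin-width seat `ym-routeR-w1` (gen 6); standing PASS R4′ (★p1 g16 23:01Z).  THEOREMS ONLY (0 `def`, 0 `sorry`); `--supports stmt-QuantumFields-19200`,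
count-neutral.  YM₃ on T³ is a ladder rung (R3), not the Clay problem; nothing here claims a stub, the crux, d = 4 or the gap.

WHAT (ns `…Theorems.Prop7LocalModelBlendPt`; abstract shifts `T`, units `U`, weights `W`, support predicate `N`).
* `energy_second_pt` — `Σ_z (Σ_μΣ_y |Δ²_μW_y(z)|·b_y(z,μ))² ≤ |ι|·G₂²·Σ_yΣ_(z : N y z)Σ_μ b_y(z,μ)²` (weighted Cauchy–Schwarz ✓ `wcs2`; `|Δ²_μW_y(z)| ≤ G₂` pointwise from the row mass; support).
* ★★ `sum_sq_norm_lap_localBlend_le_pt`, ★★★ `sum_sq_norm_lap_localBlend_le_supp_pt` — ✓p665619's two theorems with the third group replaced as above (first two groups verbatim).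
HONEST SCOPE.  Pure algebra ∕ Cauchy–Schwarz; no background hypothesis.

References: T. Bałaban, CMP 99 (1985) 389–434 [Balaban1985BackgroundPropagators] ((3.3)–(3.4) pp.390–391, (3.8) p.392, Thm 3.11 p.416); CMP 95 (1984) 17–40
[Balaban1984PropagatorsI] ((1.29)–(1.31) p.23).
-/

set_option autoImplicit false

noncomputable section

open scoped BigOperators

namespace Summit.QuantumFields.YangMills.Theorems.Prop7LocalModelBlendPt

open Literature.MathematicalPhysics.QuantumFieldTheory.Balaban1983to89
open B9Eq39Adjoint (R covD covDstar divB)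
open Summit.QuantumFields.YangMills.Theorems.Prop7HermiteCornerBlendEnergy (wcs2)
open Summit.QuantumFields.YangMills.Theorems.Prop7LocalModelBlend (norm_lap_localBlend_le energy_main_local energy_grad_local)

/-! ## §1 The second-difference group with pointwise entries -/

section Energy

variable {S : Type*} [Fintype S] {ι : Type*} [Fintype ι] (T : ι → Equiv.Perm S) {Y : Type*} [Fintype Y]

/-- `Σ_z (Σ_μΣ_y |Δ²_μW_y(z)|·b_y(z,μ))² ≤ |ι|·G₂²·Σ_yΣ_(z : N y z)Σ_μ b_y(z,μ)²` for second-difference weights of row mass `G₂` vanishing off the support `N`.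
[cite: Balaban1985BackgroundPropagators, (3.3)-(3.4) pp.390-391, Thm 3.11 p.416] -/
theorem energy_second_pt (W : Y → S → ℝ) (G₂ : ℝ) (hG₂ : 0 ≤ G₂)
    (hM2 : ∀ (z : S) (μ : ι), ∑ y, |(W y (T μ z) - W y z) - (W y z - W y ((T μ).symm z))| ≤ G₂)
    (N : Y → S → Prop) [∀ y z, Decidable (N y z)] (hN : ∀ y z, ¬ N y z → W y z = 0 ∧ (∀ μ, W y (T μ z) = 0) ∧ (∀ μ, W y ((T μ).symm z) = 0))
    (b : Y → S → ι → ℝ) :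
    ∑ z, (∑ μ, ∑ y, |(W y (T μ z) - W y z) - (W y z - W y ((T μ).symm z))| * b y z μ) ^ 2
      ≤ (Fintype.card ι : ℝ) * G₂ ^ 2 * ∑ y, ∑ z, (if N y z then ∑ μ, b y z μ ^ 2 else 0) := by
  -- pointwise bound of one second difference by the row mass, and vanishing off the support
  have hpt : ∀ (z : S) (μ : ι) (y : Y), |(W y (T μ z) - W y z) - (W y z - W y ((T μ).symm z))| ≤ if N y z then G₂ else 0 := by
    intro z μ y
    by_cases hn : N y z
    · rw [if_pos hn]
      exact (Finset.single_le_sum (f := fun y' => |(W y' (T μ z) - W y' z) - (W y' z - W y' ((T μ).symm z))|) (fun _ _ => abs_nonneg _)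
        (Finset.mem_univ y)).trans (hM2 z μ)
    · obtain ⟨h0, hp, hm⟩ := hN y z hn
      rw [if_neg hn, h0, hp μ, hm μ]; simp
  have hz : ∀ z : S, (∑ μ, ∑ y, |(W y (T μ z) - W y z) - (W y z - W y ((T μ).symm z))| * b y z μ) ^ 2
      ≤ (Fintype.card ι : ℝ) * G₂ * (G₂ * ∑ y, (if N y z then ∑ μ, b y z μ ^ 2 else 0)) := by
    intro z
    have cs := wcs2 (fun μ y => |(W y (T μ z) - W y z) - (W y z - W y ((T μ).symm z))|) (fun μ y => b y z μ) (fun _ _ => abs_nonneg _)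
    have mass : ∑ μ, ∑ y, |(W y (T μ z) - W y z) - (W y z - W y ((T μ).symm z))| ≤ (Fintype.card ι : ℝ) * G₂ :=
      calc ∑ μ, ∑ y, |(W y (T μ z) - W y z) - (W y z - W y ((T μ).symm z))| ≤ ∑ _μ : ι, G₂ := Finset.sum_le_sum fun μ _ => hM2 z μ
        _ = (Fintype.card ι : ℝ) * G₂ := by rw [Finset.sum_const, Finset.card_univ, nsmul_eq_mul]
    have second : ∑ μ, ∑ y, |(W y (T μ z) - W y z) - (W y z - W y ((T μ).symm z))| * b y z μ ^ 2
        ≤ G₂ * ∑ y, (if N y z then ∑ μ, b y z μ ^ 2 else 0) := by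
      rw [Finset.sum_comm, Finset.mul_sum]
      refine Finset.sum_le_sum fun y _ => ?_
      by_cases hn : N y z
      · rw [if_pos hn, Finset.mul_sum]
        refine Finset.sum_le_sum fun μ _ => mul_le_mul_of_nonneg_right ?_ (sq_nonneg _)
        have e := hpt z μ y; rw [if_pos hn] at e; exact e
      · rw [if_neg hn, mul_zero]
        refine le_of_eq (Finset.sum_eq_zero fun μ _ => ?_)
        have e := hpt z μ y; rw [if_neg hn] at e
        rw [le_antisymm e (abs_nonneg _), zero_mul]
    exact cs.trans (mul_le_mul mass second (Finset.sum_nonneg fun _ _ => Finset.sum_nonneg fun _ _ => mul_nonneg (abs_nonneg _) (sq_nonneg _))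
      (by positivity))
  calc ∑ z, (∑ μ, ∑ y, |(W y (T μ z) - W y z) - (W y z - W y ((T μ).symm z))| * b y z μ) ^ 2
      ≤ ∑ z, (Fintype.card ι : ℝ) * G₂ * (G₂ * ∑ y, (if N y z then ∑ μ, b y z μ ^ 2 else 0)) := Finset.sum_le_sum fun z _ => hz z
    _ = (Fintype.card ι : ℝ) * G₂ ^ 2 * ∑ z, ∑ y, (if N y z then ∑ μ, b y z μ ^ 2 else 0) := by
        rw [Finset.mul_sum]; exact Finset.sum_congr rfl fun z _ => by ring
    _ = (Fintype.card ι : ℝ) * G₂ ^ 2 * ∑ y, ∑ z, (if N y z then ∑ μ, b y z μ ^ 2 else 0) := by rw [Finset.sum_comm]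

end Energy

/-! ## §2 The Laplacian energy of the blend with the pointwise recentring group -/

section Main

variable {𝔸 : Type*} [NormedRing 𝔸] [NormedAlgebra ℝ 𝔸] {S : Type*} [Fintype S] {ι : Type*} [Fintype ι] (T : ι → Equiv.Perm S) (U : ι → S → 𝔸ˣ)
  {Y : Type*} [Fintype Y]

/-- ★★ **THE LAPLACIAN ENERGY OF THE LOCAL-MODEL BLEND, POINTWISE RECENTRING GROUP**: ✓ `sum_sq_norm_lap_localBlend_le` with the third group
`3·|ι|·G₂²·Σ_yΣ_(z : N y z)Σ_μ‖Ψ_y(z) − Z_μ(z)‖²` (no sup-type data row). [cite: Balaban1985BackgroundPropagators, (3.3)-(3.4) pp.390-391, (3.8) p.392, Thm 3.11 p.416] -/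
theorem sum_sq_norm_lap_localBlend_le_pt
    (W : Y → S → ℝ) (hW1 : ∀ z : S, ∑ y, W y z = 1) (hW0 : ∀ y z, 0 ≤ W y z) (Ψ : Y → S → 𝔸)
    (N : Y → S → Prop) [∀ y z, Decidable (N y z)] (hN : ∀ y z, ¬ N y z → W y z = 0 ∧ (∀ μ, W y (T μ z) = 0) ∧ (∀ μ, W y ((T μ).symm z) = 0))
    (Z : ι → S → 𝔸) (G₁ G₂ : ℝ) (hG₂ : 0 ≤ G₂)
    (hM1 : ∀ (z : S) (μ : ι), ∑ y, |W y (T μ z) - W y z| ≤ G₁)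
    (hM2 : ∀ (z : S) (μ : ι), ∑ y, |(W y (T μ z) - W y z) - (W y z - W y ((T μ).symm z))| ≤ G₂) :
    ∑ z, ‖divB T U (fun μ => covD T U μ (fun z' => ∑ y, W y z' • Ψ y z')) z‖ ^ 2
      ≤ 3 * ∑ z, ∑ y, W y z * ‖divB T U (fun μ => covD T U μ (Ψ y)) z‖ ^ 2
        + 3 * (2 * (Fintype.card ι : ℝ) * G₁)
          * ∑ z, ∑ y, ∑ μ, (|W y z - W y ((T μ).symm z)| * ‖covDstar T U μ (Ψ y) z‖ ^ 2 + |W y (T μ z) - W y z| * ‖covD T U μ (Ψ y) z‖ ^ 2)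
        + 3 * ((Fintype.card ι : ℝ) * G₂ ^ 2) * ∑ y, ∑ z, (if N y z then ∑ μ, ‖Ψ y z - Z μ z‖ ^ 2 else 0) := by
  have h3 : ∀ a b e : ℝ, (a + b + e) ^ 2 ≤ 3 * (a ^ 2 + b ^ 2 + e ^ 2) := fun a b e => by
    nlinarith [sq_nonneg (a - b), sq_nonneg (b - e), sq_nonneg (a - e)]
  have hpt : ∀ z : S, ‖divB T U (fun μ => covD T U μ (fun z' => ∑ y, W y z' • Ψ y z')) z‖
      ≤ ∑ y, W y z * ‖divB T U (fun μ => covD T U μ (Ψ y)) z‖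
        + ∑ y, ∑ μ, (|W y z - W y ((T μ).symm z)| * ‖covDstar T U μ (Ψ y) z‖ + |W y (T μ z) - W y z| * ‖covD T U μ (Ψ y) z‖)
        + ∑ μ, ∑ y, |(W y (T μ z) - W y z) - (W y z - W y ((T μ).symm z))| * ‖Ψ y z - Z μ z‖ := fun z => by
    refine (norm_lap_localBlend_le T U W hW1 Ψ z (fun μ => Z μ z)).trans (add_le_add (add_le_add (le_of_eq ?_) le_rfl) le_rfl)
    exact Finset.sum_congr rfl fun y _ => by rw [abs_of_nonneg (hW0 y z)]
  have hsq : ∀ z : S, ‖divB T U (fun μ => covD T U μ (fun z' => ∑ y, W y z' • Ψ y z')) z‖ ^ 2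
      ≤ 3 * ((∑ y, W y z * ‖divB T U (fun μ => covD T U μ (Ψ y)) z‖) ^ 2
        + (∑ y, ∑ μ, (|W y z - W y ((T μ).symm z)| * ‖covDstar T U μ (Ψ y) z‖ + |W y (T μ z) - W y z| * ‖covD T U μ (Ψ y) z‖)) ^ 2
        + (∑ μ, ∑ y, |(W y (T μ z) - W y z) - (W y z - W y ((T μ).symm z))| * ‖Ψ y z - Z μ z‖) ^ 2) :=
    fun z => (pow_le_pow_left₀ (norm_nonneg _) (hpt z) 2).trans (h3 _ _ _)
  have eA := energy_main_local W hW1 hW0 (fun y z => ‖divB T U (fun μ => covD T U μ (Ψ y)) z‖)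
  have eB := energy_grad_local T W G₁ hM1 (fun y μ z => ‖covDstar T U μ (Ψ y) z‖) (fun y μ z => ‖covD T U μ (Ψ y) z‖)
  have eC := energy_second_pt T W G₂ hG₂ hM2 N hN (fun y z μ => ‖Ψ y z - Z μ z‖)
  calc ∑ z, ‖divB T U (fun μ => covD T U μ (fun z' => ∑ y, W y z' • Ψ y z')) z‖ ^ 2
      ≤ ∑ z, 3 * ((∑ y, W y z * ‖divB T U (fun μ => covD T U μ (Ψ y)) z‖) ^ 2
        + (∑ y, ∑ μ, (|W y z - W y ((T μ).symm z)| * ‖covDstar T U μ (Ψ y) z‖ + |W y (T μ z) - W y z| * ‖covD T U μ (Ψ y) z‖)) ^ 2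
        + (∑ μ, ∑ y, |(W y (T μ z) - W y z) - (W y z - W y ((T μ).symm z))| * ‖Ψ y z - Z μ z‖) ^ 2) := Finset.sum_le_sum fun z _ => hsq z
    _ = 3 * ∑ z, (∑ y, W y z * ‖divB T U (fun μ => covD T U μ (Ψ y)) z‖) ^ 2
        + 3 * ∑ z, (∑ y, ∑ μ, (|W y z - W y ((T μ).symm z)| * ‖covDstar T U μ (Ψ y) z‖ + |W y (T μ z) - W y z| * ‖covD T U μ (Ψ y) z‖)) ^ 2
        + 3 * ∑ z, (∑ μ, ∑ y, |(W y (T μ z) - W y z) - (W y z - W y ((T μ).symm z))| * ‖Ψ y z - Z μ z‖) ^ 2 := by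
        rw [Finset.mul_sum, Finset.mul_sum, Finset.mul_sum, ← Finset.sum_add_distrib, ← Finset.sum_add_distrib]
        exact Finset.sum_congr rfl fun z _ => by ring
    _ ≤ 3 * ∑ z, ∑ y, W y z * ‖divB T U (fun μ => covD T U μ (Ψ y)) z‖ ^ 2
        + 3 * ((2 * (Fintype.card ι : ℝ) * G₁)
          * ∑ z, ∑ y, ∑ μ, (|W y z - W y ((T μ).symm z)| * ‖covDstar T U μ (Ψ y) z‖ ^ 2 + |W y (T μ z) - W y z| * ‖covD T U μ (Ψ y) z‖ ^ 2))
        + 3 * ((Fintype.card ι : ℝ) * G₂ ^ 2 * ∑ y, ∑ z, (if N y z then ∑ μ, ‖Ψ y z - Z μ z‖ ^ 2 else 0)) :=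
        add_le_add (add_le_add (mul_le_mul_of_nonneg_left eA (by norm_num)) (mul_le_mul_of_nonneg_left eB (by norm_num)))
          (mul_le_mul_of_nonneg_left eC (by norm_num))
    _ = _ := by ring

/-- ★★★ **THE SAME WITH THE WEIGHTS ELIMINATED ON THE SUPPORT** (pointwise recentring group): ✓ `sum_sq_norm_lap_localBlend_le_supp` with the third group
`3·|ι|·G₂²·Σ_yΣ_(z : N y z)Σ_μ‖Ψ_y(z) − Z_μ(z)‖²`. [cite: Balaban1985BackgroundPropagators, (3.3)-(3.4) pp.390-391, Thm 3.11 p.416; Balaban1984PropagatorsI, (1.29)-(1.31) p.23] -/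
theorem sum_sq_norm_lap_localBlend_le_supp_pt
    (W : Y → S → ℝ) (hW1 : ∀ z : S, ∑ y, W y z = 1) (hW0 : ∀ y z, 0 ≤ W y z) (hWle : ∀ y z, W y z ≤ 1) (Ψ : Y → S → 𝔸)
    (N : Y → S → Prop) [∀ y z, Decidable (N y z)]
    (hN : ∀ y z, ¬ N y z → W y z = 0 ∧ (∀ μ, W y (T μ z) = 0) ∧ (∀ μ, W y ((T μ).symm z) = 0))
    (Z : ι → S → 𝔸) (g₁ G₁ G₂ : ℝ) (hG₁ : 0 ≤ G₁) (hG₂ : 0 ≤ G₂)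
    (hg₁ : ∀ (y : Y) (z : S) (μ : ι), |W y (T μ z) - W y z| ≤ g₁)
    (hM1 : ∀ (z : S) (μ : ι), ∑ y, |W y (T μ z) - W y z| ≤ G₁)
    (hM2 : ∀ (z : S) (μ : ι), ∑ y, |(W y (T μ z) - W y z) - (W y z - W y ((T μ).symm z))| ≤ G₂) :
    ∑ z, ‖divB T U (fun μ => covD T U μ (fun z' => ∑ y, W y z' • Ψ y z')) z‖ ^ 2
      ≤ 3 * ∑ y, ∑ z, (if N y z then ‖divB T U (fun μ => covD T U μ (Ψ y)) z‖ ^ 2 else 0)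
        + 3 * (2 * (Fintype.card ι : ℝ) * G₁) * g₁
          * ∑ y, ∑ z, (if N y z then ∑ μ, (‖covDstar T U μ (Ψ y) z‖ ^ 2 + ‖covD T U μ (Ψ y) z‖ ^ 2) else 0)
        + 3 * ((Fintype.card ι : ℝ) * G₂ ^ 2) * ∑ y, ∑ z, (if N y z then ∑ μ, ‖Ψ y z - Z μ z‖ ^ 2 else 0) := by
  have main := sum_sq_norm_lap_localBlend_le_pt T U W hW1 hW0 Ψ N hN Z G₁ G₂ hG₂ hM1 hM2
  refine main.trans (add_le_add (add_le_add ?_ ?_) le_rfl)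
  · -- main group: `W_y(z) ≤ 1` on `N`, `W_y(z) = 0` off `N`
    rw [Finset.sum_comm]
    refine mul_le_mul_of_nonneg_left (Finset.sum_le_sum fun y _ => Finset.sum_le_sum fun z _ => ?_) (by norm_num)
    by_cases hn : N y z
    · rw [if_pos hn]
      exact (mul_le_mul_of_nonneg_right (hWle y z) (sq_nonneg _)).trans (le_of_eq (one_mul _))
    · rw [if_neg hn, (hN y z hn).1, zero_mul]
  · -- gradient group: `|∂W_y(z)| ≤ g₁` on `N`, `= 0` off `N`
    have hc : 0 ≤ 3 * (2 * (Fintype.card ι : ℝ) * G₁) := by positivity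
    calc 3 * (2 * (Fintype.card ι : ℝ) * G₁)
          * ∑ z, ∑ y, ∑ μ, (|W y z - W y ((T μ).symm z)| * ‖covDstar T U μ (Ψ y) z‖ ^ 2 + |W y (T μ z) - W y z| * ‖covD T U μ (Ψ y) z‖ ^ 2)
        ≤ 3 * (2 * (Fintype.card ι : ℝ) * G₁)
          * (g₁ * ∑ y, ∑ z, (if N y z then ∑ μ, (‖covDstar T U μ (Ψ y) z‖ ^ 2 + ‖covD T U μ (Ψ y) z‖ ^ 2) else 0)) :=
          mul_le_mul_of_nonneg_left ?_ hc
      _ = _ := by ring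
    rw [Finset.sum_comm, Finset.mul_sum]
    refine Finset.sum_le_sum fun y _ => ?_
    rw [Finset.mul_sum]
    refine Finset.sum_le_sum fun z _ => ?_
    by_cases hn : N y z
    · rw [if_pos hn, Finset.mul_sum]
      refine Finset.sum_le_sum fun μ _ => ?_
      have a1 : |W y z - W y ((T μ).symm z)| ≤ g₁ := by
        have e := hg₁ y ((T μ).symm z) μ
        simp only [Equiv.apply_symm_apply] at e
        exact e
      have a2 : |W y (T μ z) - W y z| ≤ g₁ := hg₁ y z μ
      calc |W y z - W y ((T μ).symm z)| * ‖covDstar T U μ (Ψ y) z‖ ^ 2 + |W y (T μ z) - W y z| * ‖covD T U μ (Ψ y) z‖ ^ 2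
          ≤ g₁ * ‖covDstar T U μ (Ψ y) z‖ ^ 2 + g₁ * ‖covD T U μ (Ψ y) z‖ ^ 2 :=
            add_le_add (mul_le_mul_of_nonneg_right a1 (sq_nonneg _)) (mul_le_mul_of_nonneg_right a2 (sq_nonneg _))
        _ = g₁ * (‖covDstar T U μ (Ψ y) z‖ ^ 2 + ‖covD T U μ (Ψ y) z‖ ^ 2) := by ring
    · obtain ⟨h0, hp, hm⟩ := hN y z hn
      rw [if_neg hn, mul_zero]
      refine le_of_eq (Finset.sum_eq_zero fun μ _ => ?_)
      rw [h0, hp μ, hm μ]; simp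

end Main

end Summit.QuantumFields.YangMills.Theorems.Prop7LocalModelBlendPt

end
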